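import Summits.QuantumFields.YangMills.Theorems.SwapVirialDeficitSigmaBallSlab
import HarnessLib

/-!
# END-CORE LEADER-SIDE INTEGRALS, brick (S1b): the end slab in the letters `(δ, x₀, y₀)` with LEAD's `u`-free rate `B₀` and the E1 weights —
# `∫⁻_{|δ|<s} ∫_{ℝ²} (1+x₀²)⁻¹(1+y₀²)⁻¹·B₀⁻¹ ≤ 36·s^{1/3} + π²·s`
# (stub `stub_core_end` of skeleton ➎, leader side; LEAD sfw-p2 g99 memo10 §2 + answer 2026-08-31 21:56Z (a) with
# `B₀(δ,x₀,y₀) = 16δ²/(1+δ²) + 8x₀²/((1+x₀²)(1+δ²)) + 4y₀²/(1+y₀²)`; free-hands support of ⟨stmt-QuantumFields-24197⟩ `SwapVirialDeficit.SwapGluedStiffness`)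

After the `u`-first (✓`lintegral_uFirst_le`, weight `(1+x₀²)⁻¹/κ`) and `y⊥`-first (same lemma, weight `(1+y₀²)⁻¹`) steps the leader side of the end core is the
3-letter integral of `(1+x₀²)⁻¹(1+y₀²)⁻¹·B₀⁻¹` over the hub slab `|δ| < s` (`s ≍ √τ`, `s ≤ 1`).  This file bounds it:
* `lintegral_inv_one_add_sq` / `lintegral_inv_one_add_sq_prod` (`∫(1+x²)⁻¹ = π`, `∫∫ = π²` in `ℝ≥0∞`);
* ★ `slab_integrand_le` — pointwise on `δ² ≤ 1`: `(1+x₀²)⁻¹(1+y₀²)⁻¹B₀⁻¹ ≤ ½·𝟙_{|x₀|,|y₀|<1}·(δ²+x₀²+y₀²)⁻¹ + ½·(1+x₀²)⁻¹(1+y₀²)⁻¹`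
  (unit box: `B₀ ≥ 2(δ²+x₀²+y₀²)`; exterior: `B₀ ≥ 2`);
* ★★ `lintegral_endSlab_le (hs0 : 0 ≤ s) (hs1 : s ≤ 1) : ∫⁻_{Ioo(−s)s ×ˢ univ} ofReal((1+x₀²)⁻¹(1+y₀²)⁻¹B₀⁻¹) ≤ ofReal(36·s^{1/3} + π²·s)` on `ℝ × ℝ × ℝ`
  (Σ-patch by ✓`lintegral_symm_slab_inv_sum_sq_le`, exterior by the product structure) — polynomially small in the hub cut, as memo8 §2(c) wants.

HONEST LABEL: elementary real analysis (Mathlib + ✓SigmaBallModel/Slab); `stub_core_end` (assembly LEAD, follower side w2 g60), stubs B (closing, g48 ⧗p835693) ∕ core-tip ∕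
001-good, ⟨24197⟩ ∕ ⟨24194⟩ and every rung OPEN; own crux ⟨22884⟩ OPEN (blocked-on ⟨19935⟩); the Yang–Mills mass gap is NOT proved; no summit is proved by a line.
THEOREMS ONLY (0 `def`, 0 `sorry`), standard axioms.  Width seat ym-line-sfw-p2-w3 g67 (cell ym-idea-1, free hands), `--supports stmt-QuantumFields-24197`.  References: [folklore].
-/

set_option autoImplicit false

noncomputable section

open MeasureTheory Set Real
open scoped ENNReal

namespace Summit.QuantumFields.YangMills.Theorems.SwapVirialDeficit.SigmaBall

/-- `∫⁻_ℝ (1+x²)⁻¹ = π` in `ℝ≥0∞`. [folklore] -/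
theorem lintegral_inv_one_add_sq : ∫⁻ x : ℝ, ENNReal.ofReal ((1 + x ^ 2)⁻¹) = ENNReal.ofReal π := by
  rw [← integral_univ_inv_one_add_sq, ofReal_integral_eq_lintegral_ofReal integrable_inv_one_add_sq
    (Filter.Eventually.of_forall fun x => by positivity)]

/-- `∫⁻_{ℝ²} (1+x²)⁻¹(1+y²)⁻¹ = π²`. [folklore] -/
theorem lintegral_inv_one_add_sq_prod :
    ∫⁻ q : ℝ × ℝ, ENNReal.ofReal ((1 + q.1 ^ 2)⁻¹ * (1 + q.2 ^ 2)⁻¹) = ENNReal.ofReal (π ^ 2) := by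
  have e : (fun q : ℝ × ℝ => ENNReal.ofReal ((1 + q.1 ^ 2)⁻¹ * (1 + q.2 ^ 2)⁻¹)) =
      fun q => ENNReal.ofReal ((1 + q.1 ^ 2)⁻¹) * ENNReal.ofReal ((1 + q.2 ^ 2)⁻¹) := by
    funext q; rw [ENNReal.ofReal_mul (by positivity)]
  rw [e, Measure.volume_eq_prod,
    lintegral_prod_mul (f := fun x : ℝ => ENNReal.ofReal ((1 + x ^ 2)⁻¹)) (g := fun y : ℝ => ENNReal.ofReal ((1 + y ^ 2)⁻¹)) (by fun_prop) (by fun_prop),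
    lintegral_inv_one_add_sq, ← ENNReal.ofReal_mul (by positivity)]
  congr 1; ring
set_option maxHeartbeats 400000 in
/-- ★ The pointwise majorant of the slab integrand: for `|δ| ≤ 1` and all `x₀, y₀`,
`(1+x₀²)⁻¹(1+y₀²)⁻¹·B₀⁻¹ ≤ ½·𝟙_{|x₀|<1,|y₀|<1}·(δ²+x₀²+y₀²)⁻¹ + ½·(1+x₀²)⁻¹(1+y₀²)⁻¹`,
`B₀ = 16δ²/(1+δ²) + 8x₀²/((1+x₀²)(1+δ²)) + 4y₀²/(1+y₀²)` (LEAD sfw-p2 g99, 2026-08-31 21:56Z). [folklore] -/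
theorem slab_integrand_le {δ x₀ y₀ : ℝ} (hδ : δ ^ 2 ≤ 1) :
    (1 + x₀ ^ 2)⁻¹ * (1 + y₀ ^ 2)⁻¹ * (16 * δ ^ 2 / (1 + δ ^ 2) + 8 * x₀ ^ 2 / ((1 + x₀ ^ 2) * (1 + δ ^ 2)) + 4 * y₀ ^ 2 / (1 + y₀ ^ 2))⁻¹ ≤
      (1 / 2) * (Ioo (-1:ℝ) 1 ×ˢ Ioo (-1:ℝ) 1).indicator (fun q : ℝ × ℝ => (δ ^ 2 + q.1 ^ 2 + q.2 ^ 2)⁻¹) (x₀, y₀) +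
        (1 / 2) * ((1 + x₀ ^ 2)⁻¹ * (1 + y₀ ^ 2)⁻¹) := by
  set B₀ : ℝ := 16 * δ ^ 2 / (1 + δ ^ 2) + 8 * x₀ ^ 2 / ((1 + x₀ ^ 2) * (1 + δ ^ 2)) + 4 * y₀ ^ 2 / (1 + y₀ ^ 2) with hB₀
  have hd : 0 < 1 + δ ^ 2 := by positivity
  have hx : 0 < 1 + x₀ ^ 2 := by positivity
  have hy : 0 < 1 + y₀ ^ 2 := by positivity
  have hB₀nn : 0 ≤ B₀ := by positivity
  have hw1 : (1 + x₀ ^ 2)⁻¹ * (1 + y₀ ^ 2)⁻¹ ≤ 1 := by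
    rw [← mul_inv]; apply inv_le_one_of_one_le₀; nlinarith [sq_nonneg x₀, sq_nonneg y₀, mul_nonneg (sq_nonneg x₀) (sq_nonneg y₀)]
  have hw0 : 0 ≤ (1 + x₀ ^ 2)⁻¹ * (1 + y₀ ^ 2)⁻¹ := by positivity
  have hind0 : 0 ≤ (Ioo (-1:ℝ) 1 ×ˢ Ioo (-1:ℝ) 1).indicator (fun q : ℝ × ℝ => (δ ^ 2 + q.1 ^ 2 + q.2 ^ 2)⁻¹) (x₀, y₀) :=
    Set.indicator_nonneg (fun q _ => by positivity) _
  -- the three lower bounds for the terms of `B₀`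
  have t1 : 8 * δ ^ 2 ≤ 16 * δ ^ 2 / (1 + δ ^ 2) := by rw [le_div_iff₀ hd]; nlinarith [sq_nonneg δ]
  have t3 : 4 * y₀ ^ 2 / (1 + y₀ ^ 2) ≥ 0 := by positivity
  by_cases hbox : (x₀, y₀) ∈ Ioo (-1:ℝ) 1 ×ˢ Ioo (-1:ℝ) 1
  · -- inside the unit box: `B₀ ≥ 2(δ² + x₀² + y₀²)`
    rw [Set.indicator_of_mem hbox]
    obtain ⟨⟨hx1, hx2⟩, ⟨hy1, hy2⟩⟩ := hbox
    have hx1' : x₀ ^ 2 < 1 := by nlinarith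
    have hy1' : y₀ ^ 2 < 1 := by nlinarith
    have t2 : 2 * x₀ ^ 2 ≤ 8 * x₀ ^ 2 / ((1 + x₀ ^ 2) * (1 + δ ^ 2)) := by
      rw [le_div_iff₀ (by positivity)]; nlinarith [sq_nonneg x₀, sq_nonneg δ, mul_nonneg (sq_nonneg x₀) (sq_nonneg δ)]
    have t3' : 2 * y₀ ^ 2 ≤ 4 * y₀ ^ 2 / (1 + y₀ ^ 2) := by rw [le_div_iff₀ hy]; nlinarith [sq_nonneg y₀]
    have hB : 2 * (δ ^ 2 + x₀ ^ 2 + y₀ ^ 2) ≤ B₀ := by rw [hB₀]; linarith [sq_nonneg δ]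
    rcases (show 0 ≤ δ ^ 2 + x₀ ^ 2 + y₀ ^ 2 by positivity).eq_or_lt with h0 | hpos
    · -- the origin: both sides vanish/are non-negative
      have : B₀⁻¹ ≥ 0 := inv_nonneg.2 hB₀nn
      have hδ0 : δ ^ 2 = 0 := by nlinarith [sq_nonneg δ, sq_nonneg x₀, sq_nonneg y₀]
      have hx0 : x₀ ^ 2 = 0 := by nlinarith [sq_nonneg δ, sq_nonneg x₀, sq_nonneg y₀]
      have hy0 : y₀ ^ 2 = 0 := by nlinarith [sq_nonneg δ, sq_nonneg x₀, sq_nonneg y₀]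
      have hB0' : B₀ = 0 := by rw [hB₀, hδ0, hx0, hy0]; simp
      rw [hB0', inv_zero, mul_zero]
      positivity
    · have hBpos : 0 < B₀ := by linarith
      have h1 : B₀⁻¹ ≤ (1 / 2) * (δ ^ 2 + x₀ ^ 2 + y₀ ^ 2)⁻¹ := by
        rw [show (1 / 2 : ℝ) * (δ ^ 2 + x₀ ^ 2 + y₀ ^ 2)⁻¹ = (2 * (δ ^ 2 + x₀ ^ 2 + y₀ ^ 2))⁻¹ by rw [mul_inv]; norm_num]
        exact inv_anti₀ (by positivity) hB
      calc (1 + x₀ ^ 2)⁻¹ * (1 + y₀ ^ 2)⁻¹ * B₀⁻¹ ≤ 1 * ((1 / 2) * (δ ^ 2 + x₀ ^ 2 + y₀ ^ 2)⁻¹) :=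
            mul_le_mul hw1 h1 (inv_nonneg.2 hB₀nn) zero_le_one
        _ ≤ _ := by rw [one_mul]; linarith [hw0]
  · -- outside the box: `B₀ ≥ 2`
    rw [Set.indicator_of_notMem hbox, mul_zero, zero_add]
    have hB : 2 ≤ B₀ := by
      simp only [Set.mem_prod, Set.mem_Ioo, not_and_or, not_lt] at hbox
      rw [hB₀]
      have t2 : 0 ≤ 8 * x₀ ^ 2 / ((1 + x₀ ^ 2) * (1 + δ ^ 2)) := by positivity
      rcases hbox with hx' | hy'
      · -- |x₀| ≥ 1
        have hx2 : 1 ≤ x₀ ^ 2 := by rcases hx' with h | h <;> nlinarith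
        have t2' : 2 ≤ 8 * x₀ ^ 2 / ((1 + x₀ ^ 2) * (1 + δ ^ 2)) := by
          rw [le_div_iff₀ (by positivity)]; nlinarith [mul_nonneg (sq_nonneg x₀) (sq_nonneg δ)]
        linarith [t1, t3, sq_nonneg δ]
      · have hy2 : 1 ≤ y₀ ^ 2 := by rcases hy' with h | h <;> nlinarith
        have t3' : 2 ≤ 4 * y₀ ^ 2 / (1 + y₀ ^ 2) := by rw [le_div_iff₀ hy]; nlinarith
        linarith [t1, t2, sq_nonneg δ]
    have h1 : B₀⁻¹ ≤ 1 / 2 := by rw [show (1 / 2 : ℝ) = (2 : ℝ)⁻¹ by norm_num]; exact inv_anti₀ (by norm_num) hB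
    calc (1 + x₀ ^ 2)⁻¹ * (1 + y₀ ^ 2)⁻¹ * B₀⁻¹ ≤ (1 + x₀ ^ 2)⁻¹ * (1 + y₀ ^ 2)⁻¹ * (1 / 2) := mul_le_mul_of_nonneg_left h1 hw0
      _ = _ := by ring

/-- ★★ **THE END SLAB WITH THE E1 WEIGHTS** (`0 ≤ s ≤ 1`; letters `p = (δ, x₀, y₀) ∈ ℝ × ℝ × ℝ`, volume):
`∫⁻_{|δ|<s} ∫_{ℝ²} (1+x₀²)⁻¹(1+y₀²)⁻¹·B₀(δ,x₀,y₀)⁻¹ ≤ 36·s^{1/3} + π²·s` — the leader-side 3-letter slab integral of the end core after the `u`-first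
(✓`lintegral_uFirst_le`) and `y⊥`-first steps: Σ-patch `≲ s^{1/3}` (✓`lintegral_symm_slab_inv_sum_sq_le`) + the integrable exterior. [folklore] -/
theorem lintegral_endSlab_le {s : ℝ} (hs0 : 0 ≤ s) (hs1 : s ≤ 1) :
    ∫⁻ p in (Ioo (-s) s) ×ˢ (univ : Set (ℝ × ℝ)),
        ENNReal.ofReal ((1 + p.2.1 ^ 2)⁻¹ * (1 + p.2.2 ^ 2)⁻¹ *
          (16 * p.1 ^ 2 / (1 + p.1 ^ 2) + 8 * p.2.1 ^ 2 / ((1 + p.2.1 ^ 2) * (1 + p.1 ^ 2)) + 4 * p.2.2 ^ 2 / (1 + p.2.2 ^ 2))⁻¹)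
        ∂(volume : Measure (ℝ × ℝ × ℝ)) ≤
      ENNReal.ofReal (36 * s ^ (1 / 3 : ℝ) + π ^ 2 * s) := by
  have hslab : MeasurableSet ((Ioo (-s) s) ×ˢ (univ : Set (ℝ × ℝ))) := measurableSet_Ioo.prod MeasurableSet.univ
  have hbox : MeasurableSet ((univ : Set ℝ) ×ˢ (Ioo (-1:ℝ) 1 ×ˢ Ioo (-1:ℝ) 1)) := MeasurableSet.univ.prod (measurableSet_Ioo.prod measurableSet_Ioo)
  -- the two majorants as `ℝ≥0∞`-valued functions
  set g₁ : ℝ × ℝ × ℝ → ℝ≥0∞ := fun p => ((univ : Set ℝ) ×ˢ (Ioo (-1:ℝ) 1 ×ˢ Ioo (-1:ℝ) 1)).indicator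
    (fun p => ENNReal.ofReal ((1 / 2) * (p.1 ^ 2 + p.2.1 ^ 2 + p.2.2 ^ 2)⁻¹)) p with hg₁
  set g₂ : ℝ × ℝ × ℝ → ℝ≥0∞ := fun p => ENNReal.ofReal ((1 / 2) * ((1 + p.2.1 ^ 2)⁻¹ * (1 + p.2.2 ^ 2)⁻¹)) with hg₂
  have hg₂m : Measurable g₂ := by rw [hg₂]; exact Measurable.ennreal_ofReal (by fun_prop)
  -- pointwise on the slab
  have hpt : ∀ p ∈ (Ioo (-s) s) ×ˢ (univ : Set (ℝ × ℝ)),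
      ENNReal.ofReal ((1 + p.2.1 ^ 2)⁻¹ * (1 + p.2.2 ^ 2)⁻¹ *
          (16 * p.1 ^ 2 / (1 + p.1 ^ 2) + 8 * p.2.1 ^ 2 / ((1 + p.2.1 ^ 2) * (1 + p.1 ^ 2)) + 4 * p.2.2 ^ 2 / (1 + p.2.2 ^ 2))⁻¹) ≤ g₁ p + g₂ p := by
    rintro ⟨δ, x₀, y₀⟩ ⟨hδ, -⟩
    have hδ1 : δ ^ 2 ≤ 1 := by
      simp only [mem_Ioo] at hδ
      nlinarith [hδ.1, hδ.2]
    have h := slab_integrand_le (x₀ := x₀) (y₀ := y₀) hδ1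
    have e1 : g₁ (δ, x₀, y₀) = ENNReal.ofReal ((1 / 2) * (Ioo (-1:ℝ) 1 ×ˢ Ioo (-1:ℝ) 1).indicator (fun q : ℝ × ℝ => (δ ^ 2 + q.1 ^ 2 + q.2 ^ 2)⁻¹) (x₀, y₀)) := by
      rw [hg₁]
      beta_reduce
      by_cases hb : (x₀, y₀) ∈ Ioo (-1:ℝ) 1 ×ˢ Ioo (-1:ℝ) 1
      · rw [Set.indicator_of_mem (show (δ, x₀, y₀) ∈ (univ : Set ℝ) ×ˢ (Ioo (-1:ℝ) 1 ×ˢ Ioo (-1:ℝ) 1) from ⟨mem_univ _, hb⟩), Set.indicator_of_mem hb]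
      · rw [Set.indicator_of_notMem (show (δ, x₀, y₀) ∉ (univ : Set ℝ) ×ˢ (Ioo (-1:ℝ) 1 ×ˢ Ioo (-1:ℝ) 1) from fun h => hb h.2), Set.indicator_of_notMem hb]
        simp
    rw [e1, hg₂, ← ENNReal.ofReal_add (mul_nonneg (by norm_num) (Set.indicator_nonneg (fun q _ => by positivity) _)) (by positivity)]
    exact ENNReal.ofReal_le_ofReal h
  refine (setLIntegral_mono' hslab hpt).trans ?_
  rw [lintegral_add_right _ hg₂m]
  -- first majorant: the Σ-patch
  have h1 : ∫⁻ p in (Ioo (-s) s) ×ˢ (univ : Set (ℝ × ℝ)), g₁ p ∂(volume : Measure (ℝ × ℝ × ℝ)) ≤ ENNReal.ofReal (36 * s ^ (1 / 3 : ℝ)) := by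
    rw [hg₁, lintegral_indicator hbox, Measure.restrict_restrict hbox]
    have eset : ((univ : Set ℝ) ×ˢ (Ioo (-1:ℝ) 1 ×ˢ Ioo (-1:ℝ) 1)) ∩ ((Ioo (-s) s) ×ˢ (univ : Set (ℝ × ℝ))) = (Ioo (-s) s) ×ˢ (Ioo (-1:ℝ) 1 ×ˢ Ioo (-1:ℝ) 1) := by
      ext p; simp only [mem_inter_iff, mem_prod, mem_univ, true_and, and_true]; tauto
    rw [eset]
    have e : ∀ p : ℝ × ℝ × ℝ, ENNReal.ofReal ((1 / 2) * (p.1 ^ 2 + p.2.1 ^ 2 + p.2.2 ^ 2)⁻¹) = ENNReal.ofReal (1 / 2) * ENNReal.ofReal ((p.1 ^ 2 + p.2.1 ^ 2 + p.2.2 ^ 2)⁻¹) :=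
      fun p => ENNReal.ofReal_mul (by norm_num)
    simp_rw [e]
    rw [lintegral_const_mul _ (Measurable.ennreal_ofReal (by fun_prop))]
    calc ENNReal.ofReal (1 / 2) * ∫⁻ p in (Ioo (-s) s) ×ˢ (Ioo (-1:ℝ) 1 ×ˢ Ioo (-1:ℝ) 1), ENNReal.ofReal ((p.1 ^ 2 + p.2.1 ^ 2 + p.2.2 ^ 2)⁻¹) ∂(volume : Measure (ℝ × ℝ × ℝ))
        ≤ ENNReal.ofReal (1 / 2) * ENNReal.ofReal (72 * s ^ (1 / 3 : ℝ) * (1:ℝ) ^ (1 / 3 : ℝ) * (1:ℝ) ^ (1 / 3 : ℝ)) :=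
          mul_le_mul_right (lintegral_symm_slab_inv_sum_sq_le hs0 zero_le_one zero_le_one) _
      _ = ENNReal.ofReal (36 * s ^ (1 / 3 : ℝ)) := by
          rw [← ENNReal.ofReal_mul (by norm_num), Real.one_rpow]; congr 1; ring
  -- second majorant: the integrable exterior, product structure
  have h2 : ∫⁻ p in (Ioo (-s) s) ×ˢ (univ : Set (ℝ × ℝ)), g₂ p ∂(volume : Measure (ℝ × ℝ × ℝ)) = ENNReal.ofReal (π ^ 2 * s) := by
    rw [hg₂, Measure.volume_eq_prod, ← Measure.restrict_univ (μ := (volume : Measure (ℝ × ℝ))), ← Measure.prod_restrict]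
    simp only [Measure.restrict_univ]
    have hp := lintegral_prod_mul (μ := (volume : Measure ℝ).restrict (Ioo (-s) s)) (ν := (volume : Measure (ℝ × ℝ)))
      (f := fun _ : ℝ => (1 : ℝ≥0∞)) (g := fun q : ℝ × ℝ => ENNReal.ofReal ((1 / 2) * ((1 + q.1 ^ 2)⁻¹ * (1 + q.2 ^ 2)⁻¹))) (by fun_prop)
      (Measurable.ennreal_ofReal (by fun_prop)).aemeasurable
    simp only [one_mul] at hp
    rw [hp, lintegral_const, Measure.restrict_apply MeasurableSet.univ, univ_inter, Real.volume_Ioo, one_mul]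
    have e : ∀ q : ℝ × ℝ, ENNReal.ofReal ((1 / 2) * ((1 + q.1 ^ 2)⁻¹ * (1 + q.2 ^ 2)⁻¹)) = ENNReal.ofReal (1 / 2) * ENNReal.ofReal ((1 + q.1 ^ 2)⁻¹ * (1 + q.2 ^ 2)⁻¹) :=
      fun q => ENNReal.ofReal_mul (by norm_num)
    simp_rw [e]
    rw [lintegral_const_mul _ (Measurable.ennreal_ofReal (by fun_prop)), lintegral_inv_one_add_sq_prod, ← ENNReal.ofReal_mul (by norm_num),
      ← ENNReal.ofReal_mul (by linarith)]
    congr 1; ring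
  rw [h2]
  calc (∫⁻ p in (Ioo (-s) s) ×ˢ (univ : Set (ℝ × ℝ)), g₁ p ∂(volume : Measure (ℝ × ℝ × ℝ))) + ENNReal.ofReal (π ^ 2 * s)
      ≤ ENNReal.ofReal (36 * s ^ (1 / 3 : ℝ)) + ENNReal.ofReal (π ^ 2 * s) := add_le_add h1 le_rfl
    _ = ENNReal.ofReal (36 * s ^ (1 / 3 : ℝ) + π ^ 2 * s) := by rw [← ENNReal.ofReal_add (by positivity) (by positivity)]

end Summit.QuantumFields.YangMills.Theorems.SwapVirialDeficit.SigmaBall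

end
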